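import Mathlib
import Summits.Ventures.PercRepro2.Defs
import Summits.Ventures.PercRepro2.Graph
import Summits.Ventures.PercRepro2.OneColourSwitch
import Summits.Ventures.PercRepro2.RegionHubSign
import Summits.Ventures.PercRepro2.SideSwitch
import Summits.Ventures.PercRepro2.SideSwitchFibre
import Summits.Ventures.PercRepro2.SideSwitchClosed
import Summits.Ventures.PercRepro2.SideSwitchComps
import Summits.Ventures.PercRepro2.SideSwitchCompsFibre
import Summits.Ventures.PercRepro2.M9NoPocketDefs
import Summits.Ventures.PercRepro2.M9NoPocketWorld
import Summits.Ventures.PercRepro2.M9NoPocketWorldD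
import Summits.Ventures.PercRepro2.M9NoPocketFibre
import Summits.Ventures.PercRepro2.M9NoPocketCompl
import Summits.Ventures.PercRepro2.M9PocketCubeDefs

/-!
# The block-group cube WITH a pocket — the fibration (blind cell PercRepro2, p3 g23,
2026-08-28; `proofs/P3-HARRIS.md` §3)

The `Sep`-colourings doubly reached only at `d` are fibred over the pocket representatives
`RepP` by the legal vectors of their cubes: `(ρ, x) ↦ assignX x ρ` is a bijection
`Σ_{ρ ∈ RepP} LegalP ρ → DOneSet` with inverse `ω ↦ (repP ω, coordsP ω)`
(`sum_dOne_eq_sum_repP_legalP`).  Unlike the no-pocket chain, no characterisation of the legal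
vectors and no `NoPocketAt` hypothesis is needed: `LegalP` is the set of vectors whose assignment
lies in `DOneSet`.  The worlds of `G − d` of the representative `repP ω` are those of the block
switch of the `W`-side (`K2_endsD_repP`, `M2_endsD_repP`), because flipping `T`-edges and pocket
edges does not move them (`K2_endsD_flipF_free`).  Own work; std axioms.
-/

namespace Summit.Ventures.PercRepro2

namespace NoPocket

open Finset Classical RegionHub OneColourSwitch SideSwitch

variable {V : Type*} {E : Type*}

section Fibre

variable [Fintype V] [DecidableEq V] [Fintype E] [DecidableEq E]

variable {ends : E → Sym2 V}

omit [Fintype V] [DecidableEq V] [Fintype E] [DecidableEq E] in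
/-- Off the edges at `d`, a switch in `G` is the switch in `G − d`. -/
lemma flipTouch_eq_flipTouch_endsD_of_notMem {d : V} (S : Set V) (ω : Config E) {e : E}
    (he : d ∉ ends e) : flipTouch ends S ω e = flipTouch (endsD ends d) S ω e := by
  simp only [flipTouch, mem_touches_endsD_iff he]

/-- `repP` unfolded. -/
lemma repP_eq {d r s : V} (ω : Config E) :
    repP (ends := ends) d r s ω =
      flipTouch ends (↑(Bside (endsD ends d) r s ω) : Set V)
        (flipF (wT ends d r s ω ∪ yPk ends d r s ω) ω) := rfl

/-- `coordsP` unfolded. -/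
lemma coordsP_eq {d r s : V} (ω : Config E) :
    coordsP (ends := ends) d r s ω =
      ((blocks ends d r s ω).filter (fun C => C ⊆ Bside (endsD ends d) r s ω),
        wT ends d r s ω ∪ yPk ends d r s ω) := rfl

/-- The unexplored part of `G − d` is preserved by the switch of the `W`-side. -/
lemma Oprime_flipTouch_Bside {p q r s d : V} (hr : d ≠ r) (hs : d ≠ s) {ω : Config E}
    (hω : ω ∈ DOneSet ends p q r s d) :
    Oprime ends d r s (flipTouch (endsD ends d) (↑(Bside (endsD ends d) r s ω) : Set V) ω) =
      Oprime ends d r s ω := by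
  obtain ⟨hsep, hD⟩ := mem_DOneSet.1 hω
  have hsep' := sep2_endsD_of_sep2 (d := d) hsep
  have hD' := DZero_endsD_of_DOne hr hs hD
  obtain ⟨hC, hCr, hCs⟩ := subset_U2_of_subset_A0 (Bside_subset_A0 (ends := endsD ends d) r s ω)
  simp only [Oprime, Oset]
  rw [U2_flipTouch_of_closed hsep' hC hCr hCs (closedIn_Bside hsep' hD')]

/-- The free edges are preserved by the switch of the `W`-side. -/
lemma freeE_flipTouch_Bside {p q r s d : V} (hr : d ≠ r) (hs : d ≠ s) {ω : Config E}
    (hω : ω ∈ DOneSet ends p q r s d) :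
    freeE ends d r s (flipTouch (endsD ends d) (↑(Bside (endsD ends d) r s ω) : Set V) ω) =
      freeE ends d r s ω := by
  simp only [freeE, Pk, Oprime_flipTouch_Bside hr hs hω]

/-- The `Y`-world of `G − d` of `repP ω` is that of the switch of the `W`-side. -/
lemma K2_endsD_repP_eq {p q r s d : V} (hr : d ≠ r) (hs : d ≠ s) {ω : Config E}
    (hω : ω ∈ DOneSet ends p q r s d) :
    K2 (endsD ends d) r s (repP (ends := ends) d r s ω) =
      K2 (endsD ends d) r s (flipTouch (endsD ends d) (↑(Bside (endsD ends d) r s ω) : Set V) ω) := by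
  rw [repP_eq, K2_endsD_eq_of_eqOn (fun _ he => flipTouch_eq_flipTouch_endsD_of_notMem _ _ he) r s,
    ← flipF_flipTouch_comm]
  exact K2_endsD_flipF_free hr hs (by rw [freeE_flipTouch_Bside hr hs hω]; exact coords_snd_subset_freeE ω)

/-- The `W`-world of `G − d` of `repP ω` is that of the switch of the `W`-side. -/
lemma M2_endsD_repP_eq {p q r s d : V} (hr : d ≠ r) (hs : d ≠ s) {ω : Config E}
    (hω : ω ∈ DOneSet ends p q r s d) :
    M2 (endsD ends d) r s (repP (ends := ends) d r s ω) =
      M2 (endsD ends d) r s (flipTouch (endsD ends d) (↑(Bside (endsD ends d) r s ω) : Set V) ω) := by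
  rw [repP_eq, M2_endsD_eq_of_eqOn (fun _ he => flipTouch_eq_flipTouch_endsD_of_notMem _ _ he) r s,
    ← flipF_flipTouch_comm]
  exact M2_endsD_flipF_free hr hs (by rw [freeE_flipTouch_Bside hr hs hω]; exact coords_snd_subset_freeE ω)

/-- The `Y`-world of `G − d` of the representative of a colouring doubly reached only at `d`. -/
lemma K2_endsD_repP {p q r s d : V} (hr : d ≠ r) (hs : d ≠ s) {ω : Config E}
    (hω : ω ∈ DOneSet ends p q r s d) :
    K2 (endsD ends d) r s (repP (ends := ends) d r s ω) =
      (K2 (endsD ends d) r s ω \ (↑(Bside (endsD ends d) r s ω) : Set V)) ∪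
        ((↑(Bside (endsD ends d) r s ω) : Set V) ∩ M2 (endsD ends d) r s ω) := by
  obtain ⟨hsep, hD⟩ := mem_DOneSet.1 hω
  have hsep' := sep2_endsD_of_sep2 (d := d) hsep
  have hD' := DZero_endsD_of_DOne hr hs hD
  rw [K2_endsD_repP_eq hr hs hω]
  obtain ⟨hC, hCr, hCs⟩ := subset_U2_of_subset_A0 (Bside_subset_A0 (ends := endsD ends d) r s ω)
  exact K2_flipTouch_of_closed hsep' hC hCr hCs (closedIn_Bside hsep' hD')

/-- The `W`-world of `G − d` of the representative of a colouring doubly reached only at `d`. -/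
lemma M2_endsD_repP {p q r s d : V} (hr : d ≠ r) (hs : d ≠ s) {ω : Config E}
    (hω : ω ∈ DOneSet ends p q r s d) :
    M2 (endsD ends d) r s (repP (ends := ends) d r s ω) =
      (M2 (endsD ends d) r s ω \ (↑(Bside (endsD ends d) r s ω) : Set V)) ∪
        ((↑(Bside (endsD ends d) r s ω) : Set V) ∩ K2 (endsD ends d) r s ω) := by
  obtain ⟨hsep, hD⟩ := mem_DOneSet.1 hω
  have hsep' := sep2_endsD_of_sep2 (d := d) hsep
  have hD' := DZero_endsD_of_DOne hr hs hD
  rw [M2_endsD_repP_eq hr hs hω]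
  obtain ⟨hC, hCr, hCs⟩ := subset_U2_of_subset_A0 (Bside_subset_A0 (ends := endsD ends d) r s ω)
  exact M2_flipTouch_of_closed hsep' hC hCr hCs (closedIn_Bside hsep' hD')

/-- The unexplored part of `G − d` of the representative is that of the colouring. -/
lemma Oprime_repP {p q r s d : V} (hr : d ≠ r) (hs : d ≠ s) {ω : Config E}
    (hω : ω ∈ DOneSet ends p q r s d) :
    Oprime ends d r s (repP (ends := ends) d r s ω) = Oprime ends d r s ω := by
  simp only [Oprime, Oset]
  rw [K2_endsD_repP_eq hr hs hω, M2_endsD_repP_eq hr hs hω]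
  obtain ⟨hsep, hD⟩ := mem_DOneSet.1 hω
  have hsep' := sep2_endsD_of_sep2 (d := d) hsep
  have hD' := DZero_endsD_of_DOne hr hs hD
  obtain ⟨hC, hCr, hCs⟩ := subset_U2_of_subset_A0 (Bside_subset_A0 (ends := endsD ends d) r s ω)
  rw [U2_flipTouch_of_closed hsep' hC hCr hCs (closedIn_Bside hsep' hD')]

/-- The pocket edges of the representative are those of the colouring. -/
lemma Pk_repP {p q r s d : V} (hr : d ≠ r) (hs : d ≠ s) {ω : Config E}
    (hω : ω ∈ DOneSet ends p q r s d) :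
    Pk ends d r s (repP (ends := ends) d r s ω) = Pk ends d r s ω := by
  simp only [Pk, Oprime_repP hr hs hω]

omit [Fintype V] [DecidableEq E] in
/-- A `T`-edge is not a pocket edge. -/
lemma Tset_not_mem_Pk {d r s : V} (ρ : Config E) {e : E} (he : e ∈ Tset ends d r s) :
    e ∉ Pk ends d r s ρ := by
  intro hP
  have hw := mem_Pk.1 hP
  obtain ⟨a, ha, b, hb, hab⟩ := hw
  rcases mem_Tset.1 he with h | h <;> rw [h, Sym2.eq_iff] at hab
  · rcases hab with ⟨_, h2⟩ | ⟨_, h2⟩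
    · rw [← h2] at hb
      exact (mem_Oprime.1 hb).1 (r_mem_K2 r s ρ)
    · rw [← h2] at ha
      exact (mem_Oprime.1 ha).1 (r_mem_K2 r s ρ)
  · rcases hab with ⟨_, h2⟩ | ⟨_, h2⟩
    · rw [← h2] at hb
      exact (mem_Oprime.1 hb).1 (s_mem_K2 r s ρ)
    · rw [← h2] at ha
      exact (mem_Oprime.1 ha).1 (s_mem_K2 r s ρ)

omit [Fintype V] [DecidableEq E] in
/-- A pocket edge is not a `T`-edge. -/
lemma Pk_not_mem_Tset {d r s : V} {ρ : Config E} {e : E} (he : e ∈ Pk ends d r s ρ) :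
    e ∉ Tset ends d r s := fun hT => Tset_not_mem_Pk ρ hT he

omit [DecidableEq E] in
/-- A pocket edge does not touch the `W`-side of `G − d`. -/
lemma Pk_not_touches_Bside {d r s : V} {ω : Config E} {e : E} (he : e ∈ Pk ends d r s ω) :
    e ∉ touches ends (↑(Bside (endsD ends d) r s ω) : Set V) := by
  rintro ⟨y, hy, z, hyz⟩
  obtain ⟨hyM, _, _⟩ := mem_Bside.1 (Finset.mem_coe.1 hy)
  exact not_mem_within_Oprime_of_mem_world hyz (Or.inr hyM) (mem_Pk.1 he)

/-- The representative of a colouring doubly reached only at `d` is a pocket representative. -/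
lemma repP_mem_RepP {p q r s d : V} (hr : d ≠ r) (hs : d ≠ s) {ω : Config E}
    (hω : ω ∈ DOneSet ends p q r s d) : repP (ends := ends) d r s ω ∈ RepP ends p q r s d := by
  obtain ⟨hsep, hD⟩ := mem_DOneSet.1 hω
  have hsep' := sep2_endsD_of_sep2 (d := d) hsep
  have hD' := DZero_endsD_of_DOne hr hs hD
  rw [mem_RepP, mem_RepD]
  refine ⟨⟨?_, ?_, ?_⟩, ?_⟩
  · rw [sep2_iff, K2_endsD_repP hr hs hω, M2_endsD_repP hr hs hω]
    obtain ⟨⟨hpK, hqK⟩, ⟨hpM, hqM⟩⟩ := sep2_iff.1 hsep'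
    have hpB : p ∉ (↑(Bside (endsD ends d) r s ω) : Set V) := fun h =>
      hpM (mem_Bside.1 (Finset.mem_coe.1 h)).1
    have hqB : q ∉ (↑(Bside (endsD ends d) r s ω) : Set V) := fun h =>
      hqM (mem_Bside.1 (Finset.mem_coe.1 h)).1
    refine ⟨⟨?_, ?_⟩, ⟨?_, ?_⟩⟩
    · rintro (⟨h, _⟩ | ⟨h, _⟩)
      · exact hpK h
      · exact hpB h
    · rintro (⟨h, _⟩ | ⟨h, _⟩)
      · exact hqK h
      · exact hqB h
    · rintro (⟨h, _⟩ | ⟨h, _⟩)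
      · exact hpM h
      · exact hpB h
    · rintro (⟨h, _⟩ | ⟨h, _⟩)
      · exact hqM h
      · exact hqB h
  · intro y hy
    rw [M2_endsD_repP hr hs hω] at hy
    rcases hy with ⟨hyM, hyB⟩ | ⟨hyB, hyK⟩
    · by_contra h
      exact hyB (Finset.mem_coe.2 (mem_Bside.2
        ⟨hyM, fun h1 => h (Or.inl h1), fun h2 => h (Or.inr h2)⟩))
    · obtain ⟨hyM, hyr, hys⟩ := mem_Bside.1 (Finset.mem_coe.1 hyB)
      exact (hD' y hyr hys hyK hyM).elim
  · intro e he
    rw [repP_eq, flipTouch_of_notMem ends (Tset_not_touches_Bside hr hs ω he)]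
    have hnotP : e ∉ yPk ends d r s ω := fun h => Tset_not_mem_Pk ω he (yPk_subset ω h)
    by_cases h : ω e = false
    · have hmem : e ∈ wT ends d r s ω ∪ yPk ends d r s ω :=
        Finset.mem_union.2 (Or.inl (Finset.mem_filter.2 ⟨he, h⟩))
      rw [flipF_of_mem hmem, h]; rfl
    · have hmem : e ∉ wT ends d r s ω ∪ yPk ends d r s ω := fun h' => by
        rcases Finset.mem_union.1 h' with h'' | h''
        · exact h (Finset.mem_filter.1 h'').2
        · exact hnotP h''
      rw [flipF_of_notMem hmem]
      simpa using h
  · intro e he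
    rw [Pk_repP hr hs hω] at he
    rw [repP_eq, flipTouch_of_notMem ends (Pk_not_touches_Bside he)]
    have hnotT : e ∉ wT ends d r s ω := fun h => Pk_not_mem_Tset he (wT_subset ω h)
    by_cases h : ω e = true
    · have hmem : e ∈ wT ends d r s ω ∪ yPk ends d r s ω :=
        Finset.mem_union.2 (Or.inr (Finset.mem_filter.2 ⟨he, h⟩))
      rw [flipF_of_mem hmem, h]; rfl
    · have hmem : e ∉ wT ends d r s ω ∪ yPk ends d r s ω := fun h' => by
        rcases Finset.mem_union.1 h' with h'' | h''
        · exact hnotT h''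
        · exact h (Finset.mem_filter.1 h'').2
      rw [flipF_of_notMem hmem]
      simpa using h

/-- The blocks of the representative of a colouring doubly reached only at `d` are its blocks. -/
lemma blocks_repP {p q r s d : V} (hr : d ≠ r) (hs : d ≠ s) {ω : Config E}
    (hω : ω ∈ DOneSet ends p q r s d) :
    blocks ends d r s (repP (ends := ends) d r s ω) = blocks ends d r s ω := by
  obtain ⟨hsep, hD⟩ := mem_DOneSet.1 hω
  have hsep' := sep2_endsD_of_sep2 (d := d) hsep
  have hD' := DZero_endsD_of_DOne hr hs hD
  obtain ⟨hC, hCr, hCs⟩ := subset_U2_of_subset_A0 (Bside_subset_A0 (ends := endsD ends d) r s ω)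
  have h1 : A0 (endsD ends d) r s (repP (ends := ends) d r s ω) =
      A0 (endsD ends d) r s (flipTouch (endsD ends d) (↑(Bside (endsD ends d) r s ω) : Set V) ω) := by
    ext y
    simp only [mem_A0]
    rw [K2_endsD_repP_eq hr hs hω, M2_endsD_repP_eq hr hs hω]
  have h2 : A0 (endsD ends d) r s
      (flipTouch (endsD ends d) (↑(Bside (endsD ends d) r s ω) : Set V) ω) =
      A0 (endsD ends d) r s ω := by
    ext y
    simp only [mem_A0]
    rw [U2_flipTouch_of_closed hsep' hC hCr hCs (closedIn_Bside hsep' hD')]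
  simp only [blocks, comps, h1, h2]

/-- The coordinates of a colouring doubly reached only at `d` lie in the cube of its
representative. -/
lemma coordsP_mem_cubeP {p q r s d : V} (hr : d ≠ r) (hs : d ≠ s) {ω : Config E}
    (hω : ω ∈ DOneSet ends p q r s d) :
    coordsP (ends := ends) d r s ω ∈ cubeP ends d r s (repP (ends := ends) d r s ω) := by
  rw [mem_cubeP, coordsP_eq, blocks_repP hr hs hω]
  refine ⟨Finset.filter_subset _ _, ?_⟩
  simp only [freeE, Pk_repP hr hs hω]
  exact coords_snd_subset_freeE ω

/-- A colouring doubly reached only at `d` is the assignment of its coordinates to its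
representative. -/
lemma assignX_coordsP_repP {p q r s d : V} (hr : d ≠ r) (hs : d ≠ s) {ω : Config E}
    (hω : ω ∈ DOneSet ends p q r s d) :
    assignX ends (coordsP (ends := ends) d r s ω) (repP (ends := ends) d r s ω) = ω := by
  have hu : unionT (coordsP (ends := ends) d r s ω).1 = Bside (endsD ends d) r s ω := by
    obtain ⟨hsep, hD⟩ := mem_DOneSet.1 hω
    exact unionT_filter_Bside (sep2_endsD_of_sep2 (d := d) hsep) (DZero_endsD_of_DOne hr hs hD)
  rw [assignX, hu, coordsP_eq, repP_eq]
  simp only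
  rw [flipF_flipTouch_comm, flipTouch_flipTouch, flipF_flipF]

/-- The coordinates of an assignment of a pocket representative are the assigned vector. -/
lemma coordsP_assignX {p q r s d : V} (hr : d ≠ r) (hs : d ≠ s) {ρ : Config E}
    (hρ : ρ ∈ RepP ends p q r s d) {x : Finset (Finset V) × Finset E}
    (hx : x ∈ cubeP ends d r s ρ) : coordsP (ends := ends) d r s (assignX ends x ρ) = x := by
  obtain ⟨hρD, hW⟩ := mem_RepP.1 hρ
  obtain ⟨hT, hF⟩ := mem_cubeP.1 hx
  rw [coordsP_eq, Bside_endsD_assignX' hr hs hρD hT hF, blocks_assignX' hr hs hρD hT hF]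
  simp only [blocks]
  rw [filter_subset_unionT (ends := endsD ends d) hT]
  refine Prod.ext rfl ?_
  simp only [wT, yPk, Pk_assignX' hr hs hρD hT hF]
  ext e
  simp only [Finset.mem_union, Finset.mem_filter]
  constructor
  · rintro (⟨he, h⟩ | ⟨he, h⟩)
    · exact (assignX_Tset_eq_false_iff hρD hT hr hs he).1 h
    · rw [assignX_Pk hρD hT he] at h
      by_contra hx2
      rw [if_neg hx2, hW e he] at h
      exact Bool.false_ne_true h
  · intro he
    rcases mem_freeE.1 (hF he) with hTe | hPe
    · exact Or.inl ⟨hTe, (assignX_Tset_eq_false_iff hρD hT hr hs hTe).2 he⟩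
    · refine Or.inr ⟨hPe, ?_⟩
      rw [assignX_Pk hρD hT hPe, if_pos he, hW e hPe]
      rfl

/-- The representative of an assignment of a pocket representative is the representative. -/
lemma repP_assignX {p q r s d : V} (hr : d ≠ r) (hs : d ≠ s) {ρ : Config E}
    (hρ : ρ ∈ RepP ends p q r s d) {x : Finset (Finset V) × Finset E}
    (hx : x ∈ cubeP ends d r s ρ) : repP (ends := ends) d r s (assignX ends x ρ) = ρ := by
  obtain ⟨hρD, _⟩ := mem_RepP.1 hρ
  obtain ⟨hT, hF⟩ := mem_cubeP.1 hx
  have hc := coordsP_assignX hr hs hρ hx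
  rw [coordsP_eq] at hc
  have h2 : wT ends d r s (assignX ends x ρ) ∪ yPk ends d r s (assignX ends x ρ) = x.2 :=
    congrArg Prod.snd hc
  rw [repP_eq, Bside_endsD_assignX' hr hs hρD hT hF, h2, assignX, flipF_flipTouch_comm,
    flipTouch_flipTouch, flipF_flipF]

/-- **The fibration**: the `Sep`-colourings doubly reached only at `d` are the legal assignments
of the pocket representatives, each exactly once. -/
theorem sum_dOne_eq_sum_repP_legalP {p q r s d : V} (hr : d ≠ r) (hs : d ≠ s)
    (f : Config E → ℤ) :
    ∑ ω ∈ DOneSet ends p q r s d, f ω =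
      ∑ ρ ∈ RepP ends p q r s d, ∑ x ∈ LegalP ends p q r s d ρ, f (assignX ends x ρ) := by
  have hmaps : ∀ ω ∈ DOneSet ends p q r s d, repP (ends := ends) d r s ω ∈ RepP ends p q r s d :=
    fun ω hω => repP_mem_RepP hr hs hω
  rw [← Finset.sum_fiberwise_of_maps_to hmaps]
  refine Finset.sum_congr rfl (fun ρ hρ => ?_)
  refine Finset.sum_nbij' (fun ω => coordsP (ends := ends) d r s ω) (fun x => assignX ends x ρ)
    ?_ ?_ ?_ ?_ ?_
  · intro ω hω
    rw [Finset.mem_filter] at hω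
    obtain ⟨hωD, hωρ⟩ := hω
    rw [mem_LegalP, ← hωρ, assignX_coordsP_repP hr hs hωD]
    exact ⟨coordsP_mem_cubeP hr hs hωD, hωD⟩
  · intro x hx
    rw [Finset.mem_filter]
    obtain ⟨hxc, hxD⟩ := mem_LegalP.1 hx
    exact ⟨hxD, repP_assignX hr hs hρ hxc⟩
  · intro ω hω
    rw [Finset.mem_filter] at hω
    obtain ⟨hωD, hωρ⟩ := hω
    rw [← hωρ]
    exact assignX_coordsP_repP hr hs hωD
  · intro x hx
    obtain ⟨hxc, _⟩ := mem_LegalP.1 hx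
    exact coordsP_assignX hr hs hρ hxc
  · intro ω hω
    rw [Finset.mem_filter] at hω
    obtain ⟨hωD, hωρ⟩ := hω
    rw [← hωρ, assignX_coordsP_repP hr hs hωD]

end Fibre

end NoPocket

end Summit.Ventures.PercRepro2
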